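import Mathlib
import Summits.Ventures.DiscreteObjects.Mahler.SalemSignCertificate
import Summits.Ventures.DiscreteObjects.Mahler.CensusData10to18

/-!
# Kernel certificate for the degree-12 height-1 Salem core `c12_02` (venture `DiscreteObjects`, target L)

Cell `pub-namedobj`, seat `pub-namedobj-mahler` (gen 10). Framing: lottery ticket; floor = certified
bounds/negative ranges.

First use of the sign-data wrapper `salem_certificate_of_signs`: of the five degree-12 cores of the cell's
height-1 census (`CensusData10to18.coresDeg12`), `c12_02` is the Salem polynomial of the degree-12 Salem number
`1.24072642…` (trace polynomial `y⁶ − y⁵ − 5y⁴ + 4y³ + 5y² − 2y − 1`, five roots in `(−2, 2)` by the sign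
pattern at `−2, −1, −1/2, 0, 1, 2`, one root just above `2`); the other four cores have a complex pair of trace
roots.  Kernel enclosure: `1.24072642 < M(c12_02) < 1.24072643`.
-/

namespace Summit.Ventures.DiscreteObjects.Mahler

open Polynomial

/-- `traceLift` of the trace polynomial of `c12_02` is the core `c12_02`. -/
theorem traceLift_c12_02 :
    traceLift (X ^ 6 - X ^ 5 - C 5 * X ^ 4 + C 4 * X ^ 3 + C 5 * X ^ 2 - C 2 * X - 1 : ℤ[X]) = ofCoeffs c12_02 := by
  have hdeg : (X ^ 6 - X ^ 5 - C 5 * X ^ 4 + C 4 * X ^ 3 + C 5 * X ^ 2 - C 2 * X - 1 : ℤ[X]).natDegree = 6 := by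
    compute_degree!
  have hP : ofCoeffs c12_02 =
      (X ^ 12 - X ^ 11 + X ^ 10 - X ^ 9 - X ^ 6 - X ^ 3 + X ^ 2 - X + 1 : ℤ[X]) := by
    unfold ofCoeffs c12_02; simp [List.zipIdx]; ring
  rw [hP, traceLift, hdeg]
  simp only [Finset.sum_range_succ, Finset.sum_range_zero, zero_add, coeff_add, coeff_sub, coeff_X_pow,
    coeff_C_mul, coeff_X, coeff_one]
  norm_num
  ring

/-- **`1.24072642 < M(c12_02) < 1.24072643`** — the degree-12 Salem number (height-1 census core), certified in
the kernel from sign data alone. -/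
theorem c12_02_measure_enclosure :
    (124072642 / 10 ^ 8 : ℝ) < intMahlerMeasure (ofCoeffs c12_02) ∧
      intMahlerMeasure (ofCoeffs c12_02) < 124072643 / 10 ^ 8 := by
  set Q : ℤ[X] := X ^ 6 - X ^ 5 - C 5 * X ^ 4 + C 4 * X ^ 3 + C 5 * X ^ 2 - C 2 * X - 1 with hQdef
  have hQmonic : Q.Monic := by rw [hQdef]; monicity!
  have hQdeg : Q.natDegree = 6 := by rw [hQdef]; compute_degree!
  have hev : ∀ y : ℝ, aeval y Q = y ^ 6 - y ^ 5 - 5 * y ^ 4 + 4 * y ^ 3 + 5 * y ^ 2 - 2 * y - 1 := by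
    intro y
    rw [hQdef]
    simp only [map_add, map_sub, map_mul, map_pow, aeval_X, map_ofNat, map_one]
  set c₁ : ℝ := 124072642 / 10 ^ 8 with hc₁
  set c₂ : ℝ := 124072643 / 10 ^ 8 with hc₂
  obtain ⟨y, hya, hyb, hM1, hMM⟩ := salem_certificate_of_signs hQmonic
    [-2, -1, -1/2, 0, 1, 2] (by rw [hQdeg]; rfl)
    (by simp only [List.isChain_cons_cons, List.isChain_singleton, and_true]; norm_num)
    (by intro p hp; simp only [List.mem_cons, List.mem_nil_iff, or_false] at hp
        rcases hp with rfl | rfl | rfl | rfl | rfl | rfl <;> norm_num)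
    (by simp only [List.isChain_cons_cons, List.isChain_singleton, and_true, hev]; norm_num)
    (a := c₁ + c₁⁻¹) (b := c₂ + c₂⁻¹) (by rw [hc₁, hc₂]; norm_num)
    (Or.inr (by rw [hc₁]; norm_num)) (by rw [hev, hev, hc₁, hc₂]; norm_num)
  rw [traceLift_c12_02] at hM1 hMM
  have hc1y : 2 < c₁ + c₁⁻¹ := by rw [hc₁]; norm_num
  rw [abs_of_pos (by linarith)] at hMM
  have hMpos : 0 < intMahlerMeasure (ofCoeffs c12_02) := by linarith
  constructor
  · have h : c₁ + c₁⁻¹ < intMahlerMeasure (ofCoeffs c12_02) + (intMahlerMeasure (ofCoeffs c12_02))⁻¹ := by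
      rw [hMM]; linarith
    exact lt_of_add_inv_lt_add_inv hM1.le (by rw [hc₁]; norm_num) h
  · have h : intMahlerMeasure (ofCoeffs c12_02) + (intMahlerMeasure (ofCoeffs c12_02))⁻¹ < c₂ + c₂⁻¹ := by
      rw [hMM]; linarith
    exact lt_of_add_inv_lt_add_inv (by rw [hc₂]; norm_num) hMpos h

end Summit.Ventures.DiscreteObjects.Mahler
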